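import Summits.AtomisticToContinuum.Crystallization.Theorems.FreeSplittingCertificatesStrictSplittingRuleP1Interp
import Summits.AtomisticToContinuum.Crystallization.Theorems.FreeSplittingCertificatesStrictSplittingRuleFarPencilP1Lipschitz

/-!
# `StrictSplittingRule` (stmt-AtomisticToContinuum-12560): the P1 interpolant as a FIELD ON ℝ³ — cells, faces, local finiteness, and the FAR INEQUALITY for it (P1 interpolant object, part 6)

Route `FreeSplittingCertificates`, crux r3 `StrictSplittingRule` (H12⋆ = `stub_coreJointCoercive`), unit b2b-freesplit-B gen 20.
VALUE = item (2) of HOME FAR-LEMMA-SPEC §15 (d), the P1 INTERPOLANT OBJECT on `ℝ³`: every hypothesis of gen 18's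
`farPencil4_weighted_integral_le_of_cellwise` is DISCHARGED here for the interpolant of any finitely supported lattice displacement minus any
affine field (continuity, cover, cellwise affinity with a uniform slope bound, frontiers in locally finitely many proper planes, affine
tail); part 7 (`…P1Far`) applies it.  NOT a proof of H12⋆, NOT summit progress.

Objects: `p1Field a h U y = p1Interp U (T⁻¹ y)` (chart `p1Chart`, parts 1–5) — continuous, `= U n` at the site `hcpSite a h n`, affine on
each real cell `p1RealCell a h (n, π) = {y | T⁻¹ y ∈ p1Cell (n, π)}` = a genuine tetrahedron of the hcp tet/quarter-oct honeycomb, given by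
the four affine inequalities `p1FacetFn ≥ 0` (`p1RealCell_eq`), with the explicit affine form `p1Field = p1CellConst + p1CellMap` there
(`p1Field_eq_affine`; `p1CellMap` = Σ_m (barycentric slope ∘ slab-affine inverse chart) ⊗ vertex value — the cell GRADIENT the element
algebra of `…FarTransferTet` / `hcpOctUp_receipts` consumes); the cells cover `ℝ³`, are closed and locally finite; their frontiers lie in
the faces `F (i,m) = cell ∩ {p1FacetFn = 0}` carried by the proper affine planes `p1FacetPlane`; and `p1Disp a h U b₀ A y =
p1Field a h U y − (b₀ + y·A)` has the affine tail `−(b₀ + y·A)` beyond an explicit radius.  [folklore: P1 finite elements]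
-/

noncomputable section

open Set Function Metric MeasureTheory
open scoped NNReal

namespace Summit.AtomisticToContinuum.Crystallization.Theorems.StrictSplittingRuleBirth

open Summit.AtomisticToContinuum.Crystallization.Theorems.PalmUnimodularRigidity.LayeredLawsSelectHcp (hcpSite)

variable {E : Type*} [NormedAddCommGroup E] [NormedSpace ℝ E]

/-! ## The field and its cells -/

/-- **The P1 interpolant of the lattice field `U` as a field on `ℝ³`**: `p1Interp U ∘ T⁻¹`. -/
def p1Field (a h : ℝ) (U : ℤ × ℤ × ℤ → E) (y : Fin 3 → ℝ) : E := p1Interp U (p1ChartInv a h y)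

/-- The real cell `(n, π)`: the preimage under `T⁻¹` of the chart cell — a tetrahedron with hcp-site vertices. -/
def p1RealCell (a h : ℝ) (i : (ℤ × ℤ × ℤ) × Fin 6) : Set (Fin 3 → ℝ) := {y | p1ChartInv a h y ∈ p1Cell i}

/-- Continuity of the field. -/
theorem continuous_p1Field (a h : ℝ) (U : ℤ × ℤ × ℤ → E) : Continuous (p1Field a h U) :=
  (continuous_p1Interp U).comp (continuous_p1ChartInv a h)

/-- **Interpolation**: the field takes the value `U n` at the hcp site `y_n`. -/
theorem p1Field_hcpSite {a h : ℝ} (ha : a ≠ 0) (hh : h ≠ 0) (U : ℤ × ℤ × ℤ → E) (n : ℤ × ℤ × ℤ) :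
    p1Field a h U (fun i => hcpSite a h n i) = U n := by
  rw [p1Field, p1ChartInv_hcpSite ha hh, p1Interp_p1Vec]

/-- **Cover**: every point of `ℝ³` lies in some real cell. -/
theorem exists_p1RealCell (a h : ℝ) (y : Fin 3 → ℝ) : ∃ i, y ∈ p1RealCell a h i :=
  exists_p1Cell (p1ChartInv a h y)

/-- The real cells are closed. -/
theorem isClosed_p1RealCell (a h : ℝ) (i : (ℤ × ℤ × ℤ) × Fin 6) : IsClosed (p1RealCell a h i) :=
  (isClosed_p1Cell i).preimage (continuous_p1ChartInv a h)

/-- A real cell lies in the real slab of its cube: `n.1 ≤ y₂/h ≤ n.1 + 1`. -/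
theorem p1RealCell_slab {a h : ℝ} {i : (ℤ × ℤ × ℤ) × Fin 6} {y : Fin 3 → ℝ} (hy : y ∈ p1RealCell a h i) :
    (i.1.1 : ℝ) ≤ y 2 / h ∧ y 2 / h ≤ i.1.1 + 1 := by
  simpa using p1Cell_slab hy

/-! ## Affine form on a cell -/

/-- The linear part of the field on the real cell `i = (n, π)`: `Σ_m (λ_m-slope ∘ L_{n.1}) ⊗ U (n + v_m)` — the cell gradient. -/
def p1CellMap (a h : ℝ) (U : ℤ × ℤ × ℤ → E) (i : (ℤ × ℤ × ℤ) × Fin 6) : (Fin 3 → ℝ) →L[ℝ] E :=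
  ∑ m : Fin 4, ((p1BaryCLM (p1Par i.1) i.2 m).comp (p1ChartInvCLM a h i.1.1)).smulRight
    (U (i.1 + p1VertOff (p1Par i.1) i.2 m))

/-- The constant part of the field on the real cell `i = (n, π)`. -/
def p1CellConst (a h : ℝ) (U : ℤ × ℤ × ℤ → E) (i : (ℤ × ℤ × ℤ) × Fin 6) : E :=
  ∑ m : Fin 4, p1Bary (p1Par i.1) i.2 m (p1ChartInvAff a h i.1.1 0 - p1Vec i.1) • U (i.1 + p1VertOff (p1Par i.1) i.2 m)

/-- The cell map acts as `Σ_m slope_m(L y) • U_m`. -/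
theorem p1CellMap_apply (a h : ℝ) (U : ℤ × ℤ × ℤ → E) (i : (ℤ × ℤ × ℤ) × Fin 6) (y : Fin 3 → ℝ) :
    p1CellMap a h U i y =
      ∑ m : Fin 4, p1BaryCLM (p1Par i.1) i.2 m (p1ChartInvCLM a h i.1.1 y) • U (i.1 + p1VertOff (p1Par i.1) i.2 m) := by
  simp [p1CellMap]

/-- **Cellwise affinity on `ℝ³`**: on the real cell `i`, `p1Field = p1CellConst i + p1CellMap i`. -/
theorem p1Field_eq_affine {a h : ℝ} (U : ℤ × ℤ × ℤ → E) {i : (ℤ × ℤ × ℤ) × Fin 6} {y : Fin 3 → ℝ}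
    (hy : y ∈ p1RealCell a h i) : p1Field a h U y = p1CellConst a h U i + p1CellMap a h U i y := by
  obtain ⟨h0, h1⟩ := p1RealCell_slab hy
  have hq : p1ChartInv a h y ∈ p1Cell i := hy
  rw [p1Field, p1Interp_eq_sum U hq, p1ChartInv_eq_clm a h i.1.1 h0 h1, p1CellConst, p1CellMap_apply,
    ← Finset.sum_add_distrib]
  refine Finset.sum_congr rfl fun m _ => ?_
  rw [← add_smul, add_sub_right_comm, p1Bary_add]

/-! ## Facets, faces and their planes -/

/-- The `m`-th facet function of the real cell `i`: the `m`-th barycentric coordinate composed with the slab-affine inverse chart (affine in `y`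
on all of `ℝ³`). -/
def p1FacetFn (a h : ℝ) (i : (ℤ × ℤ × ℤ) × Fin 6) (m : Fin 4) (y : Fin 3 → ℝ) : ℝ :=
  p1Bary (p1Par i.1) i.2 m (p1ChartInvAff a h i.1.1 y - p1Vec i.1)

/-- The linear part of the facet function. -/
def p1FacetCLM (a h : ℝ) (i : (ℤ × ℤ × ℤ) × Fin 6) (m : Fin 4) : (Fin 3 → ℝ) →L[ℝ] ℝ :=
  (p1BaryCLM (p1Par i.1) i.2 m).comp (p1ChartInvCLM a h i.1.1)

/-- The facet function is affine: `f y = f 0 + ℓ y`. -/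
theorem p1FacetFn_eq (a h : ℝ) (i : (ℤ × ℤ × ℤ) × Fin 6) (m : Fin 4) (y : Fin 3 → ℝ) :
    p1FacetFn a h i m y = p1FacetFn a h i m 0 + p1FacetCLM a h i m y := by
  rw [p1FacetFn, p1FacetFn, p1ChartInvAff_eq a h i.1.1 y, add_sub_right_comm, p1Bary_add]
  rfl

/-- Continuity of the facet functions. -/
theorem continuous_p1FacetFn (a h : ℝ) (i : (ℤ × ℤ × ℤ) × Fin 6) (m : Fin 4) : Continuous (p1FacetFn a h i m) := by
  have : p1FacetFn a h i m = fun y => p1FacetFn a h i m 0 + p1FacetCLM a h i m y := funext (p1FacetFn_eq a h i m)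
  rw [this]
  exact continuous_const.add (p1FacetCLM a h i m).continuous

/-- **The real cell by four affine inequalities**: `p1RealCell i = {y | ∀ m, 0 ≤ p1FacetFn i m y}`. -/
theorem p1RealCell_eq (a h : ℝ) (i : (ℤ × ℤ × ℤ) × Fin 6) : p1RealCell a h i = {y | ∀ m, 0 ≤ p1FacetFn a h i m y} := by
  ext y
  constructor
  · intro hy m
    obtain ⟨h0, h1⟩ := p1RealCell_slab hy
    have hy' : p1ChartInv a h y - p1Vec i.1 ∈ p1RefCell (p1Par i.1) i.2 := hy
    rw [p1ChartInv_eq_affine a h i.1.1 h0 h1] at hy'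
    exact hy' m
  · intro hy
    have hmem : p1ChartInvAff a h i.1.1 y - p1Vec i.1 ∈ p1RefCell (p1Par i.1) i.2 := hy
    have hcube := p1RefCell_subset_cube hmem 0
    simp only [Pi.sub_apply, p1Vec_zero] at hcube
    have h0 : (i.1.1 : ℝ) ≤ y 2 / h := by have := hcube.1; simp [p1ChartInvAff] at this ⊢; linarith
    have h1 : y 2 / h ≤ i.1.1 + 1 := by have := hcube.2; simp [p1ChartInvAff] at this ⊢; linarith
    show p1ChartInv a h y - p1Vec i.1 ∈ p1RefCell (p1Par i.1) i.2
    rw [p1ChartInv_eq_affine a h i.1.1 h0 h1]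
    exact hmem

/-- The `m`-th closed face of the real cell `i`: the cell intersected with the zero set of the `m`-th facet function. -/
def p1Face (a h : ℝ) (k : ((ℤ × ℤ × ℤ) × Fin 6) × Fin 4) : Set (Fin 3 → ℝ) :=
  p1RealCell a h k.1 ∩ {y | p1FacetFn a h k.1 k.2 y = 0}

/-- The plane carrying the `m`-th face of the real cell `i` (an affine subspace: zero set of an affine function). -/
def p1FacetPlane (a h : ℝ) (k : ((ℤ × ℤ × ℤ) × Fin 6) × Fin 4) : AffineSubspace ℝ (Fin 3 → ℝ) where
  carrier := {y | p1FacetFn a h k.1 k.2 y = 0}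
  smul_vsub_vadd_mem' := by
    intro c y₁ y₂ y₃ h₁ h₂ h₃
    simp only [mem_setOf_eq, vsub_eq_sub, vadd_eq_add] at h₁ h₂ h₃ ⊢
    have e := p1FacetFn_eq a h k.1 k.2
    rw [e] at h₁ h₂ h₃ ⊢
    rw [map_add, map_smul, map_sub, smul_eq_mul]
    linear_combination h₃ + c * (h₁ - h₂)

/-- The faces lie in their planes. -/
theorem p1Face_subset_plane (a h : ℝ) (k : ((ℤ × ℤ × ℤ) × Fin 6) × Fin 4) :
    p1Face a h k ⊆ (p1FacetPlane a h k : Set (Fin 3 → ℝ)) :=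
  fun _ hy => hy.2

/-- The vertex `m` of the real cell `i` (the hcp site `T(n + v_m)`) has facet function `m` equal to `1`. -/
theorem p1FacetFn_vertex {a h : ℝ} (ha : a ≠ 0) (hh : h ≠ 0) (i : (ℤ × ℤ × ℤ) × Fin 6) (m : Fin 4) :
    p1FacetFn a h i m (p1Chart a h (p1Vec (i.1 + p1VertOff (p1Par i.1) i.2 m))) = 1 := by
  set q := p1Vec (i.1 + p1VertOff (p1Par i.1) i.2 m) with hq
  have hcell : q ∈ p1Cell i := p1Vec_vert_mem_p1Cell i m
  obtain ⟨h0, h1⟩ := p1Cell_slab hcell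
  have hy2 : p1Chart a h q 2 / h = q 0 := by simp [hh]
  have hT : p1ChartInvAff a h i.1.1 (p1Chart a h q) = q := by
    rw [← p1ChartInv_eq_affine a h i.1.1 (by rw [hy2]; exact h0) (by rw [hy2]; exact h1), p1ChartInv_p1Chart ha hh]
  rw [p1FacetFn, hT, hq, p1Vec_add, add_sub_cancel_left, p1Bary_vert]
  simp

/-- The planes of the faces are proper affine subspaces. -/
theorem p1FacetPlane_ne_top {a h : ℝ} (ha : a ≠ 0) (hh : h ≠ 0) (k : ((ℤ × ℤ × ℤ) × Fin 6) × Fin 4) :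
    p1FacetPlane a h k ≠ ⊤ := by
  intro htop
  have hmem : p1Chart a h (p1Vec (k.1.1 + p1VertOff (p1Par k.1.1) k.1.2 k.2)) ∈ (p1FacetPlane a h k : Set (Fin 3 → ℝ)) := by
    rw [htop]; simp
  have h1 := p1FacetFn_vertex ha hh k.1 k.2
  have h0 : p1FacetFn a h k.1 k.2 (p1Chart a h (p1Vec (k.1.1 + p1VertOff (p1Par k.1.1) k.1.2 k.2))) = 0 := hmem
  linarith

/-- **Frontiers lie in the faces**: a frontier point of a real cell is a zero of one of its facet functions. -/
theorem frontier_p1RealCell_subset (a h : ℝ) (i : (ℤ × ℤ × ℤ) × Fin 6) :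
    frontier (p1RealCell a h i) ⊆ ⋃ k, p1Face a h k := by
  intro y hy
  have hycl : y ∈ p1RealCell a h i := (isClosed_p1RealCell a h i).frontier_subset hy
  have hall : ∀ m, 0 ≤ p1FacetFn a h i m y := by rw [p1RealCell_eq] at hycl; exact hycl
  by_contra hcon
  have hpos : ∀ m, 0 < p1FacetFn a h i m y := by
    intro m
    rcases (hall m).lt_or_eq with hlt | heq
    · exact hlt
    · exact (hcon (mem_iUnion.2 ⟨(i, m), hycl, heq.symm⟩)).elim
  -- the open set where all facet functions are positive is contained in the cell, so `y` is interior
  have hopen : IsOpen {z : Fin 3 → ℝ | ∀ m, 0 < p1FacetFn a h i m z} := by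
    have : {z : Fin 3 → ℝ | ∀ m, 0 < p1FacetFn a h i m z} = ⋂ m, {z | 0 < p1FacetFn a h i m z} := by ext; simp
    rw [this]
    exact isOpen_iInter_of_finite fun m => isOpen_lt continuous_const (continuous_p1FacetFn a h i m)
  have hsub : {z : Fin 3 → ℝ | ∀ m, 0 < p1FacetFn a h i m z} ⊆ p1RealCell a h i := by
    rw [p1RealCell_eq]; exact fun z hz m => (hz m).le
  have hint : y ∈ interior (p1RealCell a h i) := interior_mono hsub (by rw [hopen.interior_eq]; exact hpos)
  exact hy.2 hint

/-! ## Local finiteness -/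

/-- An integer of absolute value `≤ R` (as a real) lies in `[-⌈R⌉, ⌈R⌉]`. -/
theorem int_mem_Icc_of_abs_le {z : ℤ} {R : ℝ} (h : |(z : ℝ)| ≤ R) : z ∈ Icc (-⌈R⌉) ⌈R⌉ := by
  rw [abs_le] at h
  have hc := Int.le_ceil R
  constructor
  · have : (-(⌈R⌉ : ℝ)) ≤ z := by linarith
    exact_mod_cast this
  · have : (z : ℝ) ≤ ⌈R⌉ := by linarith
    exact_mod_cast this

/-- **Local finiteness of the real cells** (for `a, h` arbitrary: `T⁻¹` is continuous, cells are tetrahedra of bounded chart size). -/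
theorem p1RealCell_locallyFinite (a h : ℝ) : LocallyFinite (p1RealCell a h) := by
  intro y
  refine ⟨closedBall y 1, closedBall_mem_nhds y one_pos, ?_⟩
  obtain ⟨R, hR⟩ : ∃ R, ∀ z ∈ closedBall y 1, ‖p1ChartInv a h z‖ ≤ R :=
    (isCompact_closedBall y 1).exists_bound_of_continuousOn (continuous_p1ChartInv a h).continuousOn
  have hbox : (Icc (-⌈R + 1⌉) ⌈R + 1⌉ ×ˢ (Icc (-⌈R + 1⌉) ⌈R + 1⌉ ×ˢ Icc (-⌈R + 1⌉) ⌈R + 1⌉) : Set (ℤ × ℤ × ℤ)).Finite :=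
    (finite_Icc _ _).prod ((finite_Icc _ _).prod (finite_Icc _ _))
  refine ((hbox.prod (finite_univ (α := Fin 6))).subset ?_)
  rintro ⟨n, π⟩ ⟨z, hzcell, hzball⟩
  refine ⟨?_, mem_univ _⟩
  have hq := hR z hzball
  have hcube := p1Cell_subset_cube hzcell
  have hc : ∀ j, |p1Vec n j| ≤ R + 1 := by
    intro j
    have h1 := (hcube j).1
    have h2 := (hcube j).2
    have h3 : |p1ChartInv a h z j| ≤ R := le_trans (norm_le_pi_norm (p1ChartInv a h z) j) hq
    rw [abs_le] at h3 ⊢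
    constructor <;> linarith [h3.1, h3.2]
  exact ⟨int_mem_Icc_of_abs_le (by simpa using hc 0), int_mem_Icc_of_abs_le (by simpa using hc 1),
    int_mem_Icc_of_abs_le (by simpa using hc 2)⟩

/-- **Local finiteness of the faces.** -/
theorem p1Face_locallyFinite (a h : ℝ) : LocallyFinite (p1Face a h) := by
  intro y
  obtain ⟨t, ht, hfin⟩ := p1RealCell_locallyFinite a h y
  refine ⟨t, ht, (hfin.prod (finite_univ (α := Fin 4))).subset ?_⟩
  rintro ⟨i, m⟩ ⟨z, hzface, hzt⟩
  exact ⟨⟨z, hzface.1, hzt⟩, mem_univ _⟩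

/-! ## Finitely supported fields: uniform slope bound and compact support -/

/-- Linear growth of the chart: `‖T q‖ ≤ (2|a| + |h|)(‖q‖ + 1)` (sup norms). -/
theorem norm_p1Chart_le (a h : ℝ) (q : Fin 3 → ℝ) : ‖p1Chart a h q‖ ≤ (2 * |a| + |h|) * (‖q‖ + 1) := by
  have hT := p1Tent_mem_Icc (q 0)
  have h0 : |q 0| ≤ ‖q‖ := norm_le_pi_norm q 0
  have h1 : |q 1| ≤ ‖q‖ := norm_le_pi_norm q 1
  have h2 : |q 2| ≤ ‖q‖ := norm_le_pi_norm q 2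
  have hq : 0 ≤ ‖q‖ := norm_nonneg q
  have ha := abs_nonneg a
  have hh := abs_nonneg h
  have h3 : (√3 : ℝ) ≤ 2 := by
    rw [show (2 : ℝ) = √4 by rw [show (4 : ℝ) = 2 ^ 2 by norm_num, Real.sqrt_sq (by norm_num)]]
    exact Real.sqrt_le_sqrt (by norm_num)
  have h3' : 0 ≤ (√3 : ℝ) := Real.sqrt_nonneg 3
  refine (pi_norm_le_iff_of_nonneg (by positivity)).2 fun j => ?_
  rw [Real.norm_eq_abs]
  rw [abs_le] at h0 h1 h2
  fin_cases j
  · simp only [Fin.zero_eta, p1Chart_apply_zero, abs_mul]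
    have : |q 1 + q 2 / 2 + p1Tent (q 0) / 2| ≤ 2 * (‖q‖ + 1) := by
      rw [abs_le]; constructor <;> linarith [hT.1, hT.2]
    calc |a| * |q 1 + q 2 / 2 + p1Tent (q 0) / 2| ≤ |a| * (2 * (‖q‖ + 1)) := by gcongr
      _ ≤ (2 * |a| + |h|) * (‖q‖ + 1) := by nlinarith
  · simp only [Fin.mk_one, p1Chart_apply_one, abs_mul, abs_div, abs_two]
    rw [abs_of_nonneg h3']
    have : |q 2 + p1Tent (q 0) / 3| ≤ ‖q‖ + 1 := by
      rw [abs_le]; constructor <;> linarith [hT.1, hT.2]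
    calc |a| * √3 / 2 * |q 2 + p1Tent (q 0) / 3| ≤ |a| * 2 / 2 * (‖q‖ + 1) := by gcongr
      _ ≤ (2 * |a| + |h|) * (‖q‖ + 1) := by nlinarith
  · simp only [Fin.reduceFinMk, p1Chart_apply_two, abs_mul]
    calc |q 0| * |h| ≤ ‖q‖ * |h| := by gcongr; exact abs_le.2 h0
      _ ≤ (2 * |a| + |h|) * (‖q‖ + 1) := by nlinarith

/-- **Compact support**: the field of a finitely supported `U` vanishes outside an explicit ball. -/
theorem p1Field_eq_zero_of_norm_le {a h : ℝ} (ha : a ≠ 0) (hh : h ≠ 0) (U : ℤ × ℤ × ℤ → E) {M : ℝ}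
    (hM : ∀ n, U n ≠ 0 → ‖p1Vec n‖ ≤ M) {y : Fin 3 → ℝ} (hy : (2 * |a| + |h|) * (M + 2) ≤ ‖y‖) : p1Field a h U y = 0 := by
  have hC : 0 < 2 * |a| + |h| := by positivity
  set q := p1ChartInv a h y with hq
  have hyq : ‖y‖ ≤ (2 * |a| + |h|) * (‖q‖ + 1) := by
    have := norm_p1Chart_le a h q
    rwa [hq, p1Chart_p1ChartInv ha hh] at this
  have hq1 : M + 1 ≤ ‖q‖ := by
    by_contra hcon
    have : (2 * |a| + |h|) * (‖q‖ + 1) < (2 * |a| + |h|) * (M + 2) := by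
      apply mul_lt_mul_of_pos_left _ hC; linarith
    linarith
  refine p1Interp_eq_zero_of_far U fun n hn => ?_
  calc (1 : ℝ) = (M + 1) - M := by ring
    _ ≤ ‖q‖ - ‖p1Vec n‖ := by linarith [hM n hn]
    _ ≤ ‖q - p1Vec n‖ := by linarith [norm_sub_norm_le q (p1Vec n)]

/-- The cell map vanishes on cells none of whose vertices carries a value. -/
theorem p1CellMap_eq_zero {a h : ℝ} (U : ℤ × ℤ × ℤ → E) {i : (ℤ × ℤ × ℤ) × Fin 6}
    (hi : ∀ m, U (i.1 + p1VertOff (p1Par i.1) i.2 m) = 0) : p1CellMap a h U i = 0 := by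
  unfold p1CellMap
  exact Finset.sum_eq_zero fun m _ => by rw [hi m, ContinuousLinearMap.smulRight_zero]

/-- **Uniform slope bound**: for finitely supported `U` the cell maps are uniformly bounded in operator norm. -/
theorem exists_bound_p1CellMap (a h : ℝ) (U : ℤ × ℤ × ℤ → E) (hU : (support U).Finite) :
    ∃ K : ℝ≥0, ∀ i, ‖p1CellMap a h U i‖₊ ≤ K := by
  classical
  -- cube origins `s - c`, `s` in the support, `c ∈ {0,1}³`
  set corners : Finset (ℤ × ℤ × ℤ) :=
    (Finset.univ : Finset (Fin 6 × Fin 4)).image fun πm => p1VertOff (true) πm.1 πm.2 with hcorners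
  set corners' : Finset (ℤ × ℤ × ℤ) :=
    (Finset.univ : Finset (Fin 6 × Fin 4)).image fun πm => p1VertOff (false) πm.1 πm.2 with hcorners'
  set S : Finset ((ℤ × ℤ × ℤ) × Fin 6) :=
    ((hU.toFinset ×ˢ (corners ∪ corners')).image fun sc => sc.1 - sc.2) ×ˢ Finset.univ with hS
  refine ⟨S.sup fun i => ‖p1CellMap a h U i‖₊, fun i => ?_⟩
  by_cases hmem : i ∈ S
  · exact Finset.le_sup (f := fun i => ‖p1CellMap a h U i‖₊) hmem
  · have hz : p1CellMap a h U i = 0 := by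
      refine p1CellMap_eq_zero U fun m => ?_
      by_contra hne
      apply hmem
      rw [hS, Finset.mem_product]
      refine ⟨Finset.mem_image.2 ⟨(i.1 + p1VertOff (p1Par i.1) i.2 m, p1VertOff (p1Par i.1) i.2 m), ?_, by simp⟩,
        Finset.mem_univ _⟩
      rw [Finset.mem_product]
      refine ⟨hU.mem_toFinset.2 hne, ?_⟩
      rw [Finset.mem_union, hcorners, hcorners']
      cases p1Par i.1
      · exact Or.inr (Finset.mem_image.2 ⟨(i.2, m), Finset.mem_univ _, rfl⟩)
      · exact Or.inl (Finset.mem_image.2 ⟨(i.2, m), Finset.mem_univ _, rfl⟩)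
    rw [hz, nnnorm_zero]
    exact bot_le

/-! ## The displacement field of the far ledger and the FAR INEQUALITY for it -/

/-- The linear map `y ↦ (Σ_i y_i A_i j)_j` as a continuous linear map. -/
def p1AffCLM (A : Fin 3 → Fin 3 → ℝ) : (Fin 3 → ℝ) →L[ℝ] (Fin 3 → ℝ) :=
  LinearMap.toContinuousLinearMap
    { toFun := fun y j => y 0 * A 0 j + y 1 * A 1 j + y 2 * A 2 j
      map_add' := fun y z => by ext j; simp only [Pi.add_apply]; ring
      map_smul' := fun c y => by ext j; simp only [Pi.smul_apply, smul_eq_mul, RingHom.id_apply]; ring }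

/-- The affine CLM acts as `y·A`. -/
@[simp] theorem p1AffCLM_apply (A : Fin 3 → Fin 3 → ℝ) (y : Fin 3 → ℝ) (j : Fin 3) :
    p1AffCLM A y j = y 0 * A 0 j + y 1 * A 1 j + y 2 * A 2 j := rfl

/-- **The far-ledger displacement field**: the P1 interpolant of the lattice displacement `U` minus the affine field `b₀ + y·A`
(in the assembly: `U d = u(p+d) − u(p)`-type relative displacements and `A` = the least-squares rotation of p's shell). -/
def p1Disp (a h : ℝ) (U : ℤ × ℤ × ℤ → (Fin 3 → ℝ)) (b₀ : Fin 3 → ℝ) (A : Fin 3 → Fin 3 → ℝ) (y : Fin 3 → ℝ) : Fin 3 → ℝ :=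
  p1Field a h U y - (b₀ + p1AffCLM A y)

/-- Continuity of the far-ledger displacement field. -/
theorem continuous_p1Disp (a h : ℝ) (U : ℤ × ℤ × ℤ → (Fin 3 → ℝ)) (b₀ : Fin 3 → ℝ) (A : Fin 3 → Fin 3 → ℝ) :
    Continuous (p1Disp a h U b₀ A) :=
  (continuous_p1Field a h U).sub (continuous_const.add (p1AffCLM A).continuous)

/-- **Cellwise affinity of the far-ledger field**: on the real cell `i`, `p1Disp = (C_i − b₀) + (L_i − A)·`. -/
theorem p1Disp_eq_affine {a h : ℝ} (U : ℤ × ℤ × ℤ → (Fin 3 → ℝ)) (b₀ : Fin 3 → ℝ) (A : Fin 3 → Fin 3 → ℝ)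
    {i : (ℤ × ℤ × ℤ) × Fin 6} {y : Fin 3 → ℝ} (hy : y ∈ p1RealCell a h i) :
    p1Disp a h U b₀ A y = (p1CellConst a h U i - b₀) + (p1CellMap a h U i - p1AffCLM A) y := by
  rw [p1Disp, p1Field_eq_affine U hy, sub_apply]
  abel

/-- Uniform operator-norm bound for the cell slopes of the far-ledger field. -/
theorem norm_p1CellMap_sub_le {a h : ℝ} {U : ℤ × ℤ × ℤ → (Fin 3 → ℝ)} {K : ℝ≥0} (hK : ∀ i, ‖p1CellMap a h U i‖₊ ≤ K)
    (A : Fin 3 → Fin 3 → ℝ) (i : (ℤ × ℤ × ℤ) × Fin 6) :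
    ‖p1CellMap a h U i - p1AffCLM A‖ ≤ ((K + ‖p1AffCLM A‖₊ : ℝ≥0) : ℝ) := by
  have hK' : ‖p1CellMap a h U i‖ ≤ K := by have := hK i; exact_mod_cast this
  have hc : ((K + ‖p1AffCLM A‖₊ : ℝ≥0) : ℝ) = K + ‖p1AffCLM A‖ := by rw [NNReal.coe_add, coe_nnnorm]
  rw [hc]
  exact (norm_sub_le _ _).trans (by linarith)

omit [NormedSpace ℝ E] in
/-- Radius of the support of a finitely supported lattice field (in chart sup-norm). -/
theorem exists_bound_support (U : ℤ × ℤ × ℤ → E) (hU : (support U).Finite) : ∃ M : ℝ, ∀ n, U n ≠ 0 → ‖p1Vec n‖ ≤ M := by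
  obtain ⟨M, hM⟩ := (hU.image fun n => ‖p1Vec n‖).bddAbove
  exact ⟨M, fun n hn => hM (mem_image_of_mem _ hn)⟩

/-- **Affine tail of the far-ledger field**: beyond the explicit radius `(2|a|+|h|)(M+2)` it is `−(b₀ + y·A)`. -/
theorem p1Disp_tail {a h : ℝ} (ha : a ≠ 0) (hh : h ≠ 0) (U : ℤ × ℤ × ℤ → (Fin 3 → ℝ)) {M : ℝ}
    (hM : ∀ n, U n ≠ 0 → ‖p1Vec n‖ ≤ M) (b₀ : Fin 3 → ℝ) (A : Fin 3 → Fin 3 → ℝ) {y : Fin 3 → ℝ}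
    (hy : (2 * |a| + |h|) * (M + 2) ≤ ‖y‖) (j : Fin 3) :
    p1Disp a h U b₀ A y j = (-b₀) j + (y 0 * (-A 0 j) + y 1 * (-A 1 j) + y 2 * (-A 2 j)) := by
  have h0 : p1Field a h U y = 0 := p1Field_eq_zero_of_norm_le ha hh U hM hy
  simp only [p1Disp, h0, zero_sub, Pi.neg_apply, Pi.add_apply, p1AffCLM_apply]
  ring

end Summit.AtomisticToContinuum.Crystallization.Theorems.StrictSplittingRuleBirth
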